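import Literature.Geometry.Lorentzian.MinkowskiStabilityCauchy
import Literature.Geometry.Lorentzian.TimelikeCompleteIsometricImmersionOnto
import Literature.Geometry.Lorentzian.ConvergenceTransport
import Literature.Geometry.Lorentzian.NormalisedNullRayCausal
import Literature.Geometry.Lorentzian.GeodesicProofs
import Literature.Geometry.Lorentzian.LeafAdaptedModelChartsMinkowski
import HarnessLib

/-!
# gr.S07 over the repaired development structure: audit of the completeness clause, and the
# reduction of the consequence form to the printed existence statement (all proved)

`Literature.Geometry.Lorentzian.MinkowskiStabilityCauchy` vendors the stability of Minkowski
space (Christodoulou–Klainerman 1993 in the smallness class of Bieri 2010, restricted to data with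
the CK fall-off) as the named fact `christodoulou_klainerman_stability_minkowski_cauchy`. This
file, written by the seat asked to discharge it (2026-08-17), records two things.

## 1. Audit: the completeness clause is stronger than the source (verdict `misstated`)

The fact concludes `IsGeodesicallyComplete 𝒟.metric.leviCivita` for every maximal vacuum Cauchy
development `𝒟` — completeness of **every** geodesic, spacelike ones included (`Geodesic.lean`:
every tangent vector is the initial velocity of a geodesic defined on all of `ℝ`). Its own
paraphrase notes record that the `ε`-ball of `dataWeightedSobolevEDist s δ`, `δ < -1/2`, controls
Bieri's smallness quantity `Q(a, x₍₀₎)` (scaling `δ = -1`) but not CK's `Q(x₍₀₎, b)` (scaling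
`δ = 0`), so that of the theorems cited only Bieri, JDG 86 (2010) = arXiv:0904.0620, Thm. 1 /
Thm. 3 apply; and Bieri fixes the meaning of the word on the page of Thm. 1 (arXiv p. 3, remark
after the Global Smallness Assumption B): **"We remark that by geodesically complete is denoted
what in GR is called g-complete which means that every causal geodesic can be extended for all
parameter values."** The printed theorem asserts *causal* geodesic completeness; completeness of
spacelike geodesics is proved in neither source (CK 1993 mention spacelike geodesics only in the
informal gloss of Thm. 1.0.1, p. 16, under their own smallness assumption (1.0.15), and nowhere in
Proof 10.2.1, pp. 237–243; Lindblad–Rodnianski, Ann. of Math. 171 (2010), Thm. 1.1, conclude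
"causally geodesically complete"). The faithful statement is the vendored one with the single
change `IsGeodesicallyComplete 𝒟.metric.leviCivita ↦ 𝒟.metric.IsCausalGeodesicallyComplete`;
under D-0014/D-0026 (no in-place change of meaning; a proving seat may not add a named fact) its
Lean text, elaborated against the tree, is recorded here for vendoring through the operator's
pre-reviewed path under the name `christodoulou_klainerman_bieri_stability_minkowski_cauchy`
(imports: `MinkowskiStabilityCauchy`):
```
def christodoulou_klainerman_bieri_stability_minkowski_cauchy : Prop :=
  ∃ (s : ℕ), ∃ δ ∈ Set.Ioo (-3 / 2 : ℝ) (-1 / 2), ∃ (k : ℕ), ∃ ε > (0 : ℝ),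
    ∀ (D : InitialDataSet 𝓘(ℝ, E3) Minkowski.slice) [D.metric.HasLeviCivita],
      D.IsVacuumConstraintSolution → D.IsMaximalData →
      (∃ M : ℝ, trivialAFEnd.IsStronglyAsymptoticallyFlatCK D M) →
      InitialDataSet.dataWeightedSobolevEDist s δ D trivialData < ENNReal.ofReal ε →
      ∀ 𝒟 : VacuumCauchyDevelopment D, 𝒟.IsMaximal → ∀ [𝒟.metric.HasLeviCivita],
        𝒟.metric.IsCausalGeodesicallyComplete ∧
          𝒟.HasCompleteFutureNullInfinity ∧
          𝒟.toSpacetime.ConvergesToMinkowski Set.univ k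
```
It is the *conclusion type* of the three theorems of §2 below (stated with this body inlined),
so that once vendored it is discharged from the printed existence statement in one line.
*Verdict clean-up (2026-08-17):* the verdict was re-verified and acted on in
`MinkowskiStabilityCauchy` — the vendored `christodoulou_klainerman_stability_minkowski_cauchy` is
now `@[deprecated]` (kept verbatim, human ruling 2026-08-15) and the corrected text above is
recorded in that file's module docstring (§Verdict clean-up) pending its declaration under the
name `christodoulou_klainerman_bieri_stability_minkowski_cauchy` by a cite/definition item (a
verdict-clean-up seat may not add an unproved named fact either, `lint.fact-fanout`); hence the
one deliberate use of the deprecated name below (`…_of_isGeodesicallyComplete_form`) runs with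
`linter.deprecated` off.

## 2. Proved: the consequence form follows from the printed existence statement

Bieri's Thm. 1 (and CK's Thm. 10.2.1, LR's Thm. 1.1) are *existence* statements — small data lead
to a globally hyperbolic, causally geodesically complete, globally asymptotically flat solution —
while the fact quantifies over *every maximal* vacuum Cauchy development. The passage is soft and
is proved here from the tree:

* `LorentzianMetric.isCausalGeodesicallyComplete_of_surjective` — causal geodesic completeness
  passes to the target of a surjective isometric immersion (O'Neill 1983, Cor. 7.29, causal
  vectors only: isometric immersions map geodesics to geodesics and preserve causal character);
* `VacuumCauchyDevelopment.IsMaximal.asymptotics_of_isCausalGeodesicallyComplete` — **if some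
  vacuum Cauchy development `𝒟₀` of `D` is causally geodesically complete and converges to
  Minkowski space in `Cᵏ`, then every maximal vacuum Cauchy development `𝒟` of `D` is causally
  geodesically complete, has complete future null infinity (sojourn form) and converges to
  Minkowski space in `Cᵏ`**: `𝒟₀` embeds into `𝒟` by maximality, *onto* by timelike completeness
  (Beem–Ehrlich 1981, Prop. 5.16 (3): `DataEmbedding.surjective_of_isTimelikeGeodesicallyComplete`,
  `TimelikeCompleteIsometricImmersionOnto.lean`), and the three properties are transported
  (`…of_surjective` above; complete `𝓘⁺` from null completeness by uniqueness of geodesics,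
  `LorentzianMetric.hasCompleteFutureNullInfinity_of_isNullGeodesicallyComplete`;
  `Spacetime.ConvergesToMinkowski.comp_of_surjective`, `ConvergenceTransport.lean`);
* `christodoulou_klainerman_bieri_stability_minkowski_cauchy_of_exists` — hence the corrected
  fact follows from its existence form (Bieri's Thm. 1 as printed, over `VacuumCauchyDevelopment`);
  `…_of_isGeodesicallyComplete_form` — and from the over-strong vendored fact;
* `Minkowski.convergesToMinkowski_vacuumCauchyDevelopment`,
  `Minkowski.asymptotics_of_isMaximal` — **sanity at the centre of the data ball, unconditional**:
  Minkowski space converges to itself (identity chart, zero deviation, covering by vertical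
  segments), so every maximal vacuum Cauchy development of the trivial data `(ℝ³, δ, 0)` is
  geodesically complete, causally geodesically complete, has complete `𝓘⁺` and converges to
  Minkowski space in every `Cᵏ`.

What is **not** here: the existence statement itself (Bieri 2010, Thm. 1 / Thm. 3; CK 1993,
Thm. 10.2.1 with the local existence theorem 10.2.2 and the bootstrap of Chs. 9–16), which has no
carrier in Mathlib or `Literature` (no local existence theory for the vacuum Einstein equations).
No definitions and no named facts are introduced (D-0026).

## References

* L. Bieri, *An extension of the stability theorem of the Minkowski space in general relativity*,
  J. Differential Geom. 86 (2010) 17–70 = arXiv:0904.0620 [held: `paper:arxiv-0904.0620`]: Def. 1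
  (arXiv p. 2), Def. 2 (AFB), `Q(a, x₍₀₎)`, Thm. 1, Global Smallness Assumption B and the remark on
  g-completeness (arXiv p. 3); Thm. 3 (arXiv p. 10); §5.1 (arXiv p. 11). Key `Bieri2010JDG`.
* D. Christodoulou, S. Klainerman, *The global nonlinear stability of the Minkowski space*,
  Princeton Math. Ser. 41 (1993) [held]: Thm. 1.0.1 p. 16; Thms. 1.0.2–1.0.3 p. 20; Thm. 10.2.1
  and Proof 10.2.1, pp. 237–243. Key `ChristodoulouKlainerman1993PMS41`.
* H. Lindblad, I. Rodnianski, Ann. of Math. 171 (2010) 1401–1477, Thm. 1.1.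
* Y. Choquet-Bruhat, R. Geroch, Comm. Math. Phys. 14 (1969) 329–335, Thm. 3.
* J. K. Beem, P. E. Ehrlich, *Global Lorentzian Geometry*, Dekker 1981, Prop. 5.16 (3).
* B. O'Neill, *Semi-Riemannian geometry with applications to relativity*, Academic Press 1983,
  Ch. 3, pp. 90–91; Ch. 7, Cor. 7.29; Ch. 14, p. 402.
* D. Christodoulou, CQG 16 (1999) A23–A35, pp. A26–A27 (complete `𝓘⁺`, sojourn form).
-/

noncomputable section

open Set Function Filter TopologicalSpace
open scoped Manifold ContDiff Topology ENNReal

universe u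

namespace Literature.Geometry.Lorentzian

/-! ### Causal geodesic completeness passes to the target of a surjective isometric immersion -/

section Transport

variable {E : Type*} [NormedAddCommGroup E] [NormedSpace ℝ E] {H : Type*} [TopologicalSpace H]
  {I : ModelWithCorners ℝ E H} {M : Type*} [TopologicalSpace M] [ChartedSpace H M]
  [IsManifold I ∞ M]
  {E' : Type*} [NormedAddCommGroup E'] [NormedSpace ℝ E'] {H' : Type*} [TopologicalSpace H']
  {I' : ModelWithCorners ℝ E' H'} {N : Type*} [TopologicalSpace N] [ChartedSpace H' N]
  [IsManifold I' ∞ N]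
  [FiniteDimensional ℝ E] [FiniteDimensional ℝ E'] [CompleteSpace E] [CompleteSpace E']
  {gN : LorentzianMetric I' ∞ N} {gM : LorentzianMetric I ∞ M} {f : N → M}

omit [CompleteSpace E] in
/-- **The target of a surjective isometric immersion with causally geodesically complete source
is causally geodesically complete** (O'Neill 1983, Ch. 7, proof of Cor. 7.29, run on causal
vectors only): every causal `u ∈ T_x M` is `df_y w` with `f y = x` (equal dimensions), `w` is
causal since `gN(w, w) = gM(df w, df w)` (`f^* gM = gN`), the geodesic `γ_w` is defined on `ℝ`,
and `f ∘ γ_w` is a geodesic of `gM` on `ℝ` with initial velocity `u` (isometric immersions map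
geodesics to geodesics, O'Neill 1983, Ch. 3, pp. 90–91).
[cite: ONeillSemiRiemannian1983, Ch. 7, Cor. 7.29] -/
theorem LorentzianMetric.isCausalGeodesicallyComplete_of_surjective [gN.HasLeviCivita]
    [gM.HasLeviCivita]
    (hf : gN.toPseudoRiemannianMetric.IsIsometricImmersion gM.toPseudoRiemannianMetric f)
    (hdim : Module.finrank ℝ E' = Module.finrank ℝ E) (hc : gN.IsCausalGeodesicallyComplete)
    (hsurj : Surjective f) : gM.IsCausalGeodesicallyComplete := by
  intro x u hu
  obtain ⟨y, rfl⟩ := hsurj x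
  obtain ⟨w, hw⟩ : ∃ w : TangentSpace I' y, mfderiv I' I f y w = u :=
    (mfderiv_bijective_of_injective (hf.injective_mfderiv y) hdim).2 u
  have key : gM.val (f y) (mfderiv I' I f y w) (mfderiv I' I f y w) = gN.val y w w := by
    have h := congrArg (fun B ↦ B w w) (hf.2 y)
    simpa only [pullbackBilin_apply] using h
  have hwc : gN.IsCausal w := by
    refine ⟨?_, fun h0 ↦ hu.2 ?_⟩
    · rw [← key, hw]
      exact hu.1
    · rw [← hw, h0, map_zero]
  obtain ⟨γ, hγ, hγ0, hγw⟩ := hc y w hwc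
  obtain ⟨hgeo, hvel⟩ := hf.isGeodesicOn_comp hdim isOpen_univ (hγ.isGeodesicOn univ)
  refine ⟨f ∘ γ, hgeo, by simp only [comp_apply, hγ0], ?_⟩
  rw [hvel 0 (mem_univ 0), ← hw]
  subst hγ0
  rw [hγw]

end Transport

/-! ### One causally complete, asymptotically Minkowskian development controls every maximal one -/

section Developments

variable {X : Type u} [TopologicalSpace X] [ChartedSpace (EuclideanSpace ℝ (Fin 3)) X]
  [IsManifold (𝓡 3) ∞ X] [ConnectedSpace X] {D : InitialDataSet (𝓡 3) X}

/-- `J⁻` is monotone in the set (the causal past is the causal future of the reversed time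
orientation, `LorentzianMetric.causalFuture_mono`). O'Neill 1983, Ch. 14, p. 403.
[cite: ONeillSemiRiemannian1983, Ch. 14, p. 403] -/
private theorem causalPast_mono' (𝓢 : Spacetime.{u} 4) {S T : Set 𝓢.carrier} (h : S ⊆ T) :
    𝓢.metric.causalPast 𝓢.timeOrientation S ⊆ 𝓢.metric.causalPast 𝓢.timeOrientation T :=
  LorentzianMetric.causalFuture_mono h

/-- **A causally geodesically complete, asymptotically Minkowskian vacuum Cauchy development
controls every maximal one.** If some vacuum Cauchy development `𝒟₀` of `D` is causally
geodesically complete and converges to Minkowski space in `Cᵏ` on all of its carrier, then every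
maximal vacuum Cauchy development `𝒟` of `D` (i) is causally geodesically complete, (ii) has
complete future null infinity in the sojourn form and (iii) converges to Minkowski space in `Cᵏ`
on all of its carrier. Proof: `𝒟₀` embeds into `𝒟` (maximality) by a smooth, time-orientation
preserving, isometric open embedding `ψ`, which is **onto** because `𝒟₀` is timelike
geodesically complete (Beem–Ehrlich 1981, Prop. 5.16 (3); Choquet-Bruhat–Geroch 1969, Thm. 3:
the complete solution is the maximal development); then (i) by
`LorentzianMetric.isCausalGeodesicallyComplete_of_surjective`, (ii) from null completeness by
uniqueness of geodesics (`hasCompleteFutureNullInfinity_of_isNullGeodesicallyComplete`), (iii) by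
`Spacetime.ConvergesToMinkowski.comp_of_surjective`. This is the step by which the stability
theorems, printed as existence statements (Bieri 2010, Thm. 1; CK 1993, Thm. 10.2.1;
Lindblad–Rodnianski 2010, Thm. 1.1 and §2), yield their consequence form over maximal
developments. [cite: ChoquetBruhatGeroch1969CMP, Thm. 3 (pp. 332–334)] -/
theorem VacuumCauchyDevelopment.IsMaximal.asymptotics_of_isCausalGeodesicallyComplete
    {𝒟₀ 𝒟 : VacuumCauchyDevelopment D} (h𝒟 : 𝒟.IsMaximal) {k : ℕ}
    (hc : ∀ [𝒟₀.metric.HasLeviCivita], 𝒟₀.metric.IsCausalGeodesicallyComplete)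
    (hconv : 𝒟₀.toSpacetime.ConvergesToMinkowski univ k) [𝒟.metric.HasLeviCivita] :
    𝒟.metric.IsCausalGeodesicallyComplete ∧ 𝒟.HasCompleteFutureNullInfinity ∧
      𝒟.toSpacetime.ConvergesToMinkowski univ k := by
  obtain ⟨ψ, hψs, hψo, hψi, hψτ, hψι⟩ := h𝒟 𝒟₀
  haveI := 𝒟₀.metric.toPseudoRiemannianMetric.hasLeviCivita
  have hsurj : Surjective ψ :=
    DataEmbedding.surjective_of_isTimelikeGeodesicallyComplete hψi hψτ
      fun x v hv ↦ hc x v hv.isCausal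
  have hcc : 𝒟.metric.IsCausalGeodesicallyComplete :=
    LorentzianMetric.isCausalGeodesicallyComplete_of_surjective hψi rfl hc hsurj
  refine ⟨hcc, ?_, hconv.comp_of_surjective hψs hψo hψi.2 hψτ hsurj⟩
  intro _
  haveI := LorentzianMetric.contMDiffCovariantDerivative_leviCivita_one 𝒟.metric
  exact LorentzianMetric.hasCompleteFutureNullInfinity_of_isNullGeodesicallyComplete
    IsGeodesicOn.eqOn_of_velocity_eq_holds
    ((𝒟.metric.isCausalGeodesicallyComplete_iff).1 hcc).2 _

/-- The same with a **geodesically complete** comparison development `𝒟₀` (all geodesics), which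
moreover makes every maximal development geodesically complete
(`IsIsometricImmersion.isGeodesicallyComplete_of_surjective`, O'Neill 1983, Cor. 7.29).
[cite: ONeillSemiRiemannian1983, Ch. 7, Cor. 7.29] -/
theorem VacuumCauchyDevelopment.IsMaximal.asymptotics_of_isGeodesicallyComplete
    {𝒟₀ 𝒟 : VacuumCauchyDevelopment D} (h𝒟 : 𝒟.IsMaximal) {k : ℕ}
    (hc : ∀ [𝒟₀.metric.HasLeviCivita], IsGeodesicallyComplete 𝒟₀.metric.leviCivita)
    (hconv : 𝒟₀.toSpacetime.ConvergesToMinkowski univ k) [𝒟.metric.HasLeviCivita] :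
    IsGeodesicallyComplete 𝒟.metric.leviCivita ∧ 𝒟.metric.IsCausalGeodesicallyComplete ∧
      𝒟.HasCompleteFutureNullInfinity ∧ 𝒟.toSpacetime.ConvergesToMinkowski univ k := by
  haveI := 𝒟₀.metric.toPseudoRiemannianMetric.hasLeviCivita
  refine ⟨?_, h𝒟.asymptotics_of_isCausalGeodesicallyComplete
    (fun x v _ ↦ hc x v) hconv⟩
  obtain ⟨ψ, -, -, hψi, hψτ, -⟩ := h𝒟 𝒟₀
  have hsurj : Surjective ψ :=
    DataEmbedding.surjective_of_isTimelikeGeodesicallyComplete hψi hψτ fun x v _ ↦ hc x v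
  exact hψi.isGeodesicallyComplete_of_surjective rfl hc hsurj

end Developments

/-! ### The corrected fact from its existence form, and from the over-strong vendored form -/

/-- **The faithful consequence form of gr.S07 follows from the printed existence statement.**
If, for some `(s, δ, k, ε)`, every small maximal CK-asymptotically-flat vacuum datum on `ℝ³`
possesses *one* vacuum Cauchy development which is causally geodesically complete and converges
to Minkowski space in `Cᵏ` — Bieri 2010, Thm. 1 as printed ("leads to a unique, globally
hyperbolic, smooth and geodesically complete [= causally complete, arXiv p. 3] solution of the EV
equations … This development is globally asymptotically flat"), read over
`VacuumCauchyDevelopment` — then the statement recorded in the module docstring as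
`christodoulou_klainerman_bieri_stability_minkowski_cauchy` holds (its body is the conclusion,
verbatim): every maximal vacuum Cauchy development of such data is causally geodesically complete,
has complete `𝓘⁺` and converges to Minkowski space
(`VacuumCauchyDevelopment.IsMaximal.asymptotics_of_isCausalGeodesicallyComplete`).
[cite: Bieri2010JDG, Thm. 1 and the remark on g-completeness (arXiv p. 3)] -/
theorem christodoulou_klainerman_bieri_stability_minkowski_cauchy_of_exists
    (hex : ∃ (s : ℕ), ∃ δ ∈ Set.Ioo (-3 / 2 : ℝ) (-1 / 2), ∃ (k : ℕ), ∃ ε > (0 : ℝ),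
      ∀ (D : InitialDataSet 𝓘(ℝ, E3) Minkowski.slice) [D.metric.HasLeviCivita],
        D.IsVacuumConstraintSolution → D.IsMaximalData →
        (∃ M : ℝ, trivialAFEnd.IsStronglyAsymptoticallyFlatCK D M) →
        InitialDataSet.dataWeightedSobolevEDist s δ D trivialData < ENNReal.ofReal ε →
        ∃ 𝒟₀ : VacuumCauchyDevelopment D,
          (∀ [𝒟₀.metric.HasLeviCivita], 𝒟₀.metric.IsCausalGeodesicallyComplete) ∧
            𝒟₀.toSpacetime.ConvergesToMinkowski Set.univ k) :
    ∃ (s : ℕ), ∃ δ ∈ Set.Ioo (-3 / 2 : ℝ) (-1 / 2), ∃ (k : ℕ), ∃ ε > (0 : ℝ),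
      ∀ (D : InitialDataSet 𝓘(ℝ, E3) Minkowski.slice) [D.metric.HasLeviCivita],
        D.IsVacuumConstraintSolution → D.IsMaximalData →
        (∃ M : ℝ, trivialAFEnd.IsStronglyAsymptoticallyFlatCK D M) →
        InitialDataSet.dataWeightedSobolevEDist s δ D trivialData < ENNReal.ofReal ε →
        ∀ 𝒟 : VacuumCauchyDevelopment D, 𝒟.IsMaximal → ∀ [𝒟.metric.HasLeviCivita],
          𝒟.metric.IsCausalGeodesicallyComplete ∧
            𝒟.HasCompleteFutureNullInfinity ∧
            𝒟.toSpacetime.ConvergesToMinkowski Set.univ k := by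
  obtain ⟨s, δ, hδ, k, ε, hε, H⟩ := hex
  refine ⟨s, δ, hδ, k, ε, hε, fun D _ hD hmax hsaf hdist 𝒟 h𝒟 _ ↦ ?_⟩
  obtain ⟨𝒟₀, hc, hconv⟩ := H D hD hmax hsaf hdist
  exact h𝒟.asymptotics_of_isCausalGeodesicallyComplete hc hconv

-- `linter.deprecated` off for this one declaration: it consumes the deprecated (misstated,
-- over-strong) fact ON PURPOSE, recording that it implies the faithful statement (verdict
-- clean-up 2026-08-17, `MinkowskiStabilityCauchy` §Verdict clean-up); remove when that `def` goes.
set_option linter.deprecated false in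
/-- **The over-strong vendored form implies the faithful one**: geodesic completeness of the
Levi-Civita connection gives causal geodesic completeness
(`LorentzianMetric.isCausalGeodesicallyComplete_of_isGeodesicallyComplete`); the other two
conclusions are identical. (The hypothesis is the `def` deprecated on 2026-08-17 for exactly this
over-strength; this theorem is its one deliberate consumer.) [cite: Bieri2010JDG, Thm. 1 (arXiv p. 3)] -/
theorem christodoulou_klainerman_bieri_stability_minkowski_cauchy_of_isGeodesicallyComplete_form
    (h : christodoulou_klainerman_stability_minkowski_cauchy) :
    ∃ (s : ℕ), ∃ δ ∈ Set.Ioo (-3 / 2 : ℝ) (-1 / 2), ∃ (k : ℕ), ∃ ε > (0 : ℝ),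
      ∀ (D : InitialDataSet 𝓘(ℝ, E3) Minkowski.slice) [D.metric.HasLeviCivita],
        D.IsVacuumConstraintSolution → D.IsMaximalData →
        (∃ M : ℝ, trivialAFEnd.IsStronglyAsymptoticallyFlatCK D M) →
        InitialDataSet.dataWeightedSobolevEDist s δ D trivialData < ENNReal.ofReal ε →
        ∀ 𝒟 : VacuumCauchyDevelopment D, 𝒟.IsMaximal → ∀ [𝒟.metric.HasLeviCivita],
          𝒟.metric.IsCausalGeodesicallyComplete ∧
            𝒟.HasCompleteFutureNullInfinity ∧
            𝒟.toSpacetime.ConvergesToMinkowski Set.univ k := by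
  obtain ⟨s, δ, hδ, k, ε, hε, H⟩ := h
  refine ⟨s, δ, hδ, k, ε, hε, fun D _ hD hmax hsaf hdist 𝒟 h𝒟 _ ↦ ?_⟩
  obtain ⟨hgeo, hscri, hconv⟩ := H D hD hmax hsaf hdist 𝒟 h𝒟
  exact ⟨fun x v _ ↦ hgeo x v, hscri, hconv⟩

/-! ### Sanity at the centre of the data ball: the trivial data (unconditional) -/

namespace Minkowski

/-- **Minkowski space converges to Minkowski space** (in every `Cᵏ`, on all of `ℝ⁴`), as the
vacuum Cauchy development of the trivial data: the identity chart `Subtype.val : E4 ⊇ ⊤ → E4` is a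
late-time embedding after `τ₀ = 0` — a late-time chart
(`isLateChart_vacuumCauchyDevelopment_subtypeVal`) which covers, since a point `x` not later than
`0` lies in the causal past of the point `(0, x̲)` of the slab `{x⁰ = 0}` (vertical timelike
segment, `mem_causalPast_vacuumCauchyDevelopment`) — along which the deviation from `η` vanishes
identically (`deviationCk_vacuumCauchyDevelopment_subtypeVal`). Christodoulou–Klainerman 1993,
Thm. 1.0.2 (Minkowski space as the trivial case). [cite: ChristodoulouKlainerman1993PMS41, Thm. 1.0.2 (p. 20)] -/
theorem convergesToMinkowski_vacuumCauchyDevelopment (k : ℕ) :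
    vacuumCauchyDevelopment.toSpacetime.ConvergesToMinkowski univ k := by
  refine ⟨0, Subtype.val, ⟨isLateChart_vacuumCauchyDevelopment_subtypeVal 0, ?_⟩, ?_⟩
  · rintro x ⟨-, hx⟩
    change E4 at x
    have hx0 : ¬ (0 : ℝ) < x 0 := fun h ↦ hx ⟨⟨x, trivial⟩, h, rfl⟩
    have hq : x ∈ vacuumCauchyDevelopment.metric.causalPast
        vacuumCauchyDevelopment.timeOrientation
        ({E4.ofTimeSpace 0 (E4.spatial x)} : Set E4) :=
      mem_causalPast_vacuumCauchyDevelopment (by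
        rw [E4.spatial_ofTimeSpace, sub_self, norm_zero, E4.ofTimeSpace_apply_zero]
        linarith [not_lt.1 hx0])
    refine causalPast_mono' vacuumCauchyDevelopment.toSpacetime (singleton_subset_iff.2 ?_) hq
    exact ⟨⟨E4.ofTimeSpace 0 (E4.spatial x), trivial⟩, E4.ofTimeSpace_apply_zero 0 (E4.spatial x), rfl⟩
  · exact tendsto_const_nhds.congr fun τ ↦
      (deviationCk_vacuumCauchyDevelopment_subtypeVal k τ).symm

/-- **Every maximal vacuum Cauchy development of the trivial data `(ℝ³, δ, 0)` is geodesically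
complete, causally geodesically complete, has complete future null infinity and converges to
Minkowski space in every `Cᵏ`** — the conclusions of gr.S07 (vendored and corrected forms) at the
centre of the data ball, unconditionally: Minkowski space is a geodesically complete vacuum Cauchy
development of the trivial data (`Minkowski.vacuumCauchyDevelopment`,
`minkowski_isGeodesicallyComplete_holds`) converging to itself
(`convergesToMinkowski_vacuumCauchyDevelopment`), so
`VacuumCauchyDevelopment.IsMaximal.asymptotics_of_isGeodesicallyComplete` applies. Ringström 2009,
Ch. 16 (Minkowski space is the maximal development of trivial data); Christodoulou, CQG 16 (1999),
p. A27 (Minkowski space has complete `𝓘⁺`). [cite: Ringstrom2009, Thm. 16.6] -/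
theorem asymptotics_of_isMaximal (k : ℕ) {𝒟 : VacuumCauchyDevelopment trivialData}
    (h𝒟 : 𝒟.IsMaximal) [𝒟.metric.HasLeviCivita] :
    IsGeodesicallyComplete 𝒟.metric.leviCivita ∧ 𝒟.metric.IsCausalGeodesicallyComplete ∧
      𝒟.HasCompleteFutureNullInfinity ∧ 𝒟.toSpacetime.ConvergesToMinkowski univ k :=
  h𝒟.asymptotics_of_isGeodesicallyComplete (𝒟₀ := vacuumCauchyDevelopment)
    @minkowski_isGeodesicallyComplete_holds (convergesToMinkowski_vacuumCauchyDevelopment k)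

end Minkowski

end Literature.Geometry.Lorentzian

end
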